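import Summits.BirchSwinnertonDyer.BirchSwinnertonDyer.Theses.UniversalToricDescent
import Summits.BirchSwinnertonDyer.BirchSwinnertonDyer.Theorems.UniversalToricDescentTwinWanFrameAtThreeMultTresTAllSplitSelfDual
import Summits.BirchSwinnertonDyer.BirchSwinnertonDyer.Theorems.UniversalToricDescentTwinFramesAtThreeOfTresSelfDual
import HarnessLib

/-!
# Route `UniversalToricDescent`, rev 73: the glue† of ♭B′ — `TwinWanFrameMultTresTOfSelfDualMemberTowerChildren`
# (stmt-BirchSwinnertonDyer-23330) BY NAME

The repaired item-level split of the crux ♭B′ `TwinWanFrameAtThreeMultTresT` (stmt-BirchSwinnertonDyer-27401) along line `membertower`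
(lead bsd-wall-utd-p2; skeleton v16) after PEN-RULING-27934-v1 (pen bsd-wall-pss3x g6; R(i) rev 72, R(ii) rev 73): three children —
`TwinHsiehThmBInput` (Hsieh 2014 Thm. B by name, item 20711), `TwinCastellaMembersFramesCongruenceOddInput` (item 23284, since rev 72 the
WEIGHT-SHARPENED supply `Castella2018.castella2020_thm211_members_frames_sigma_congruence_odd_nonsplit_wt`, p661053/p661135) and the repaired
crux K1♯† `TwinSelfDualMemberRationalInclusionAtThree` (item 23310, rev 73: K1-at-3 over the SELF-DUAL Tate twist `D.Δ.selfDualCofreeRepOver K`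
of [Castella2018Erratum, §2 p. 2], vocabulary p657158, with the weight clause `2(3−1)3^{m−1} ∣ k_m − 2` and the v14 confinement) — and this
glue† item `children ⟹ parent` (item 23330). The glue is EXACTLY the landed kernel† (5)†
`UniversalToricDescentTwinWanFrameAtThreeMultTresTAllSplitSelfDual.twinWanFrameAtThreeMultTresT_of_thmB_of_nonsplitWtMembersFrames_of_selfDualMemberRationalInclusion`
(p662412, lead g18; self-dual member tower of utd-p2-w2 g9 over bsd-stepL imc-p1 g24's member inputs†), whose three hypotheses are the three
children's texts verbatim. The legacy glue 27935 (untwisted K1, rev 59–72) stays closed history (p662112). Nothing mathematical is added here;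
the research content of the column is the child K1♯† (stmt-BirchSwinnertonDyer-23310), untouched. BSD is proved for no curve by this file.

RESTATE-ROBUST (T1 of pen pss3x g7's sequence T1 → T2 → T3, 2026-08-29T01:06:02Z; width seat bsd-wall-utd-b-w1 g2; same idiom as the
legacy glue `UniversalToricDescentTwinWanFrameMultTresTOfMemberTowerChildren` across rev 70/72): the proof is a two-branch `first | … | …` —
branch 1 = kernel† (5)† on the child K1♯† as filed (rev 73–78); branch 2 = `UniversalToricDescentTwinFramesAtThreeOfTresSelfDual`
§7 `twinWanFrameAtThreeMultTresT_of_thmB_of_nonsplitWtMembersFrames_of_tresSelfDual` (p682999) once the pen restates the child to K1♯†_T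
(= its text + the très-ramifié binder `¬ 3 ∣ padicValInt 3 W'.minimalDiscriminantInt →` after `Odd (NumberField.discr K) →`, T2). The glue's
statement and shape are unchanged; exactly one branch elaborates at any route rev.
-/

set_option linter.dupNamespace false
set_option autoImplicit false

namespace Summit.BirchSwinnertonDyer.BirchSwinnertonDyer.Theorems.UniversalToricDescentTwinWanFrameMultTresTOfSelfDualMemberTowerChildren

-- the dormant branch of a restate-robust `first | … | …` is, by design, never executed at the current route rev
set_option linter.unreachableTactic false in
set_option linter.unusedTactic false in
open Summit.BirchSwinnertonDyer.BirchSwinnertonDyer.Theses.UniversalToricDescent in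
/-- **Glue† of the repaired ♭B′ split (route rev 73), by name.** `TwinHsiehThmBInput → TwinCastellaMembersFramesCongruenceOddInput →
TwinSelfDualMemberRationalInclusionAtThree → TwinWanFrameAtThreeMultTresT` is the landed self-dual member-tower kernel† (5)† (p662412) applied
to the three children (their texts are its three hypotheses verbatim). [cite: Castella2018Erratum, §2 (p. 2), proof of Thm. 1.1 (a)(b)(c) (p. 4)]
[cite: Hsieh2014, Thm. B p. 712] [cite: Castella2020JIMJ, §2 Def. 2.10, Thm. 2.11] [cite: Skinner2016PacificMC, §2.6 (2-6-1), §3.1 (p. 192)] -/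
theorem twinWanFrameMultTresTOfSelfDualMemberTowerChildren_proof : TwinWanFrameMultTresTOfSelfDualMemberTowerChildren :=
  fun hB hC hK => by
    -- RESTATE-ROBUST (pen pss3x g7 sequence T1, 2026-08-29T01:06:02Z): branch 1 = the child K1♯† as filed (kernel† (5)†, p662412);
    -- branch 2 = the child restated to K1♯†_T (p682999 §7). Exactly one branch elaborates at any route rev.
    first
    | exact Summit.BirchSwinnertonDyer.BirchSwinnertonDyer.Theorems.UniversalToricDescentTwinWanFrameAtThreeMultTresTAllSplitSelfDual.twinWanFrameAtThreeMultTresT_of_thmB_of_nonsplitWtMembersFrames_of_selfDualMemberRationalInclusion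
        hB hC hK
    | exact Summit.BirchSwinnertonDyer.BirchSwinnertonDyer.Theorems.UniversalToricDescentTwinFramesAtThreeOfTresSelfDual.twinWanFrameAtThreeMultTresT_of_thmB_of_nonsplitWtMembersFrames_of_tresSelfDual
        hB hC hK

end Summit.BirchSwinnertonDyer.BirchSwinnertonDyer.Theorems.UniversalToricDescentTwinWanFrameMultTresTOfSelfDualMemberTowerChildren
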